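import Summits.BirchSwinnertonDyer.BirchSwinnertonDyer.Theorems.KolyvaginDepthDoorKNSupplyLargeAdmissiblePrime
import Literature.NumberTheory.EllipticCurves.SerreOpenImageFinalProofs
import Literature.NumberTheory.EllipticCurves.SupersingularDensityProofs
import Literature.NumberTheory.QuadraticFields.KroneckerSplitting
import Literature.NumberTheory.Sieve.PrimeDivisorsOfPolynomials
import HarnessLib

/-!
# Route `KolyvaginDepthDoor`, crux `KolyvaginDepthSupplyKN` (stmt-BirchSwinnertonDyer-22820) —
# admissible Kodaira–Néron primes SPLIT IN A GIVEN IMAGINARY QUADRATIC FIELD, above every bound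
# (unconditional; bookkeeping lemma (b) of the residual stub of line `levelone`, skeleton v5)

Helper file of the lead prover (kdd-p1 g12; `--supports stmt-BirchSwinnertonDyer-22820 --as helper`);
route-independent; it closes nothing and BSD is not proved by it.

The ORDER OF CHOICES of line `levelone` is: the Heegner field `K` FIRST, then the prime `p` large. The
printed route to the ♠ (2)-residual (Burungale–Castella–Grossi–Skinner 2026 Thm. 2, hypothesis (spl))
wants `p` SPLIT in `K` — which the line's prime supply
(`exists_large_admissiblePrime_kodairaNeron_of_not_hasCM`, g11) does not provide. This file supplies it
WITHOUT any density theorem, by the elementary route of the tree's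
`WeierstrassCurve.infinite_goodOrdinaryPrimes_holds` (Silverman AEC V Ex. 5.11 with Schur's theorem in
place of Chebotarev's) with one more quadratic factor: take primes `p` modulo which
`c(X) · (X² + 1) · (X² − d_K)` splits into linear factors (`c` the 2-torsion cubic of the minimal model;
Schur: `Literature.NumberTheory.Sieve.exists_prime_gt_map_int_splits_holds`); such `p > 4 + |Δ_min|`
are good ordinary (`WeierstrassCurve.mem_goodOrdinaryPrimes_of_splits`), and `d_K` is a non-zero
square mod `p`, so `p` splits in `K` (decomposition law, `ncard_primesOver_eq_two_iff_legendreSym`).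

* `exists_gt_goodOrdinary_split` — for `E/ℚ` globally minimal elliptic, `K` quadratic and any `B`:
  a prime `p > B` of good ordinary reduction that splits in `K` (`SatisfiesHeegnerHypothesis p K`).
* `exists_large_admissiblePrime_kodairaNeron_split_of_not_hasCM` — for `E` non-CM: the line's
  admissible Kodaira–Néron prime above any bound (`p ≥ 5`, good ordinary, `ρ̄_{E,p}` and the tower
  onto, `p ∤ v_ℓ(Δ_min)` / `p ∤ ord_v(Δ_min)` at multiplicative primes / places) which moreover
  SPLITS in `K` and satisfies `p ∤ d_K`.

UNCONDITIONAL (Serre's open image theorem and Schur's theorem are proved in the tree); BSD is not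
proved by this.

References: [SilvermanAEC2009] V Ex. 5.10–5.12, VII.5.1; [Serre1972] §4.2 Thm. 2; [Marcus1977] Ch. 3
Thm. 25 (decomposition law in quadratic fields); I. Schur, Sitzungsber. Berliner Math. Ges. 11 (1912).
-/

set_option linter.dupNamespace false

noncomputable section

open scoped Classical NumberField

namespace Summit.BirchSwinnertonDyer.BirchSwinnertonDyer.Theorems.KolyvaginDepthDoor

open Literature.NumberTheory.EllipticCurves Literature.NumberTheory.EllipticCurves.ModularForms
  WeierstrassCurve NumberField IsDedekindDomain Polynomial

/-- **Good ordinary primes split in a given quadratic field, above every bound (unconditional,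
elementary).** For `E/ℚ` globally minimal elliptic, `K` a quadratic field and any `B : ℕ`: there is a
prime `p > B` of good ordinary reduction for `E` (`p ∤ a_p`) which splits in `K`. Proof: Schur's
theorem gives `p > max(B, 4 + |Δ_min|, |d_K|, 2)` modulo which `c · (X² + 1) · (X² − d_K)` splits
(`c` the 2-torsion cubic of the integral minimal model); the first two factors make `p` good ordinary
(`mem_goodOrdinaryPrimes_of_splits`: `p ≡ 1 (mod 4)` and full rational 2-torsion force `4 ∣ #Ē(𝔽_p)`,
incompatible with `p ∣ a_p`); the third gives a square root of `d_K` mod `p`, `p ∤ d_K`, so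
`(d_K / p) = 1` and `p` splits (`ncard_primesOver_eq_two_iff_legendreSym`).
[cite: SilvermanAEC2009, V Exercises 5.10–5.12] [cite: Marcus1977, Ch. 3 Thm. 25] -/
theorem exists_gt_goodOrdinary_split (W : WeierstrassCurve ℚ) [W.IsElliptic] [W.IsGloballyMinimal]
    (K : Type) [Field K] [NumberField K] (h2 : Module.finrank ℚ K = 2) (B : ℕ) :
    ∃ (p : ℕ) (_ : Fact p.Prime), B < p ∧ W.HasGoodReductionAtPrime p ∧
      ¬ (p : ℤ) ∣ W.frobeniusTrace p ∧ SatisfiesHeegnerHypothesis p K := by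
  set c : ℤ[X] := (integralModelInt W).twoTorsionPolynomial.toPoly with hc
  set q : ℤ[X] := X ^ 2 - C (NumberField.discr K) with hq
  have hc0 : c ≠ 0 := Cubic.ne_zero_of_a_ne_zero (by norm_num [hc, twoTorsionPolynomial])
  have hX1 : (X ^ 2 + 1 : ℤ[X]) ≠ 0 := (Polynomial.monic_X_pow_add_C 1 two_ne_zero).ne_zero
  have hqm : q.Monic := by
    rw [hq, sub_eq_add_neg, ← C_neg]
    exact Polynomial.monic_X_pow_add_C _ two_ne_zero
  have hF0 : c * (X ^ 2 + 1) * q ≠ 0 := mul_ne_zero (mul_ne_zero hc0 hX1) hqm.ne_zero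
  obtain ⟨p, hp, hNp, hsplit⟩ :=
    Literature.NumberTheory.Sieve.exists_prime_gt_map_int_splits_holds _ hF0
      (B + 4 + (integralModelInt W).Δ.natAbs + (NumberField.discr K).natAbs)
  haveI : Fact p.Prime := ⟨hp⟩
  have hp2 : p ≠ 2 := by omega
  -- the two factors split separately
  have hmap0 : ((c * (X ^ 2 + 1) * q).map (Int.castRingHom (ZMod p))) ≠ 0 := by
    rw [Polynomial.map_mul]
    refine mul_ne_zero ?_ ((hqm.map _).ne_zero)
    rw [Polynomial.map_mul]
    refine mul_ne_zero ?_ (((Polynomial.monic_X_pow_add_C (1 : ℤ) two_ne_zero).map _).ne_zero)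
    -- `c` has leading coefficient `4 ≠ 0` mod `p ≠ 2`
    intro h0
    have hcoef : ((c.map (Int.castRingHom (ZMod p))).coeff 3) = 0 := by rw [h0, coeff_zero]
    rw [Polynomial.coeff_map, hc, Cubic.coeff_eq_a] at hcoef
    simp only [twoTorsionPolynomial, eq_intCast, Int.cast_ofNat] at hcoef
    have h4 : ((4 : ℕ) : ZMod p) = 0 := by exact_mod_cast hcoef
    rw [ZMod.natCast_eq_zero_iff] at h4
    have h22 : p ∣ 2 ^ 2 := by norm_num; exact h4
    exact hp2 ((Nat.prime_dvd_prime_iff_eq hp Nat.prime_two).mp (hp.dvd_of_dvd_pow h22))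
  have hsplit1 : ((c * (X ^ 2 + 1)).map (Int.castRingHom (ZMod p))).Splits :=
    hsplit.of_dvd hmap0 (Polynomial.map_dvd _ (dvd_mul_right _ _))
  have hsplitq : (q.map (Int.castRingHom (ZMod p))).Splits :=
    hsplit.of_dvd hmap0 (Polynomial.map_dvd _ (dvd_mul_left _ _))
  -- good ordinary
  obtain ⟨_, hgood, hord⟩ := mem_goodOrdinaryPrimes_of_splits W hp (by omega) hsplit1
  -- split in `K`: a root of `X² − d_K` mod `p`, `p ∤ d_K`
  have hqmap : q.map (Int.castRingHom (ZMod p)) = X ^ 2 - C ((NumberField.discr K : ℤ) : ZMod p) := by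
    rw [hq, Polynomial.map_sub, Polynomial.map_pow, map_X, map_C, eq_intCast]
  have hdeg : (q.map (Int.castRingHom (ZMod p))).degree ≠ 0 := by
    rw [hqmap, degree_X_pow_sub_C two_pos]; decide
  obtain ⟨r, hr⟩ := hsplitq.exists_eval_eq_zero hdeg
  rw [hqmap, eval_sub, eval_pow, eval_X, eval_C, sub_eq_zero] at hr
  have hd0 : ((NumberField.discr K : ℤ) : ZMod p) ≠ 0 := by
    intro h0
    rw [ZMod.intCast_zmod_eq_zero_iff_dvd] at h0
    have h1 : p ≤ (NumberField.discr K).natAbs :=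
      Nat.le_of_dvd (Int.natAbs_pos.mpr (NumberField.discr_ne_zero K)) (Int.natCast_dvd.mp h0)
    omega
  have hleg : legendreSym p (NumberField.discr K) = 1 :=
    (legendreSym.eq_one_iff p hd0).mpr ⟨r, by rw [← hr, sq]⟩
  have hsplitK : ((Ideal.span {(p : ℤ)}).primesOver (𝓞 K)).ncard = 2 :=
    (Literature.NumberTheory.QuadraticFields.Quadratic.ncard_primesOver_eq_two_iff_legendreSym h2 hp2).mpr
      hleg
  refine ⟨p, ⟨hp⟩, by omega, hgood, hord, fun ℓ hℓ hℓp ↦ ?_⟩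
  rw [(Nat.prime_dvd_prime_iff_eq hℓ hp).mp hℓp]
  exact hsplitK

/-- **Admissible Kodaira–Néron primes SPLIT in the Heegner field, above every bound (unconditional).**
For every non-CM globally minimal elliptic `E/ℚ`, every imaginary quadratic `K` and every `B : ℕ`
there is a prime `p > B`, `p ≥ 5`, of good ordinary reduction with `ρ̄_{E,p}` onto, `ρ̄_{E,p^n}` onto
for all `n`, `p ∤ v_ℓ(Δ_min)` at every multiplicative prime `ℓ`, `p ∤ ord_v(Δ_min)` at every
multiplicative place `v`, `p` SPLIT in `K` and `p ∤ d_K` — the line's `stub_largeAdmissiblePrime`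
(`exists_large_admissiblePrime_kodairaNeron_of_not_hasCM`) with the splitting condition (spl) of
Burungale–Castella–Grossi–Skinner 2026 added. Proof: `exists_gt_goodOrdinary_split` above
`max(B, p₀(E), 4, |Δ_min|)` with Serre's `p₀(E)` (`serre_open_image_holds`), the tower from
`forall_hasSurjectiveModNGaloisRep_pow_of_goodOrdinary_of_surj`, Kodaira–Néron from
`not_dvd_padicValInt_minimalDiscriminantInt_of_natAbs_lt` / `not_dvd_ordMinimalDiscriminant_of_natAbs_lt`,
`p ∤ d_K` because a split prime is unramified (`SatisfiesHeegnerHypothesis.not_dvd_discr`).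
Unconditional; BSD is not proved by it. [cite: Serre1972, §4.2 Thm. 2]
[cite: SerreAbelianLadic1968, Ch. IV §3.4 Lemma 3] [cite: SilvermanAEC2009, V Ex. 5.11, VII.5.1] -/
theorem exists_large_admissiblePrime_kodairaNeron_split_of_not_hasCM (W : WeierstrassCurve ℚ)
    [W.IsElliptic] [W.IsGloballyMinimal] (hW : ¬ W.HasCM)
    (K : Type) [Field K] [NumberField K] (hK : IsImaginaryQuadratic K) (B : ℕ) :
    ∃ (p : ℕ) (_ : Fact p.Prime), B < p ∧ 5 ≤ p ∧ W.HasGoodReductionAtPrime p ∧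
      ¬ (p : ℤ) ∣ W.frobeniusTrace p ∧ W.HasSurjectiveModNGaloisRep p ∧
      (∀ n : ℕ, W.HasSurjectiveModNGaloisRep (p ^ n : ℕ)) ∧
      (∀ (ℓ : ℕ) [Fact ℓ.Prime], W.HasMultiplicativeReductionAtPrime ℓ →
        ¬ p ∣ padicValInt ℓ W.minimalDiscriminantInt) ∧
      (∀ v : HeightOneSpectrum (𝓞 ℚ), W.HasMultiplicativeReductionAt v →
        ¬ p ∣ W.ordMinimalDiscriminant v) ∧
      SatisfiesHeegnerHypothesis p K ∧ ¬ ((p : ℤ) ∣ NumberField.discr K) := by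
  obtain ⟨p₀, hp₀⟩ := serre_open_image_holds W hW
  obtain ⟨p, hp, hBp, hgood, hord, hsplK⟩ :=
    exists_gt_goodOrdinary_split W K hK.1 (max (max B p₀) (max 4 W.minimalDiscriminantInt.natAbs))
  haveI := hp
  have hpP : p.Prime := hp.out
  have hB : B < p := lt_of_le_of_lt ((le_max_left _ _).trans (le_max_left _ _)) hBp
  have hp₀p : p₀ ≤ p := ((le_max_right _ _).trans (le_max_left _ _)).trans hBp.le
  have h5 : 5 ≤ p := by
    have : 4 < p := lt_of_le_of_lt ((le_max_left _ _).trans (le_max_right _ _)) hBp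
    omega
  have hΔ : W.minimalDiscriminantInt.natAbs < p :=
    lt_of_le_of_lt ((le_max_right _ _).trans (le_max_right _ _)) hBp
  have hp2 : p ≠ 2 := by omega
  have hsurj : W.HasSurjectiveModNGaloisRep p := hp₀ p hpP hp₀p
  exact ⟨p, hp, hB, h5, hgood, hord, hsurj,
    WeierstrassCurve.forall_hasSurjectiveModNGaloisRep_pow_of_goodOrdinary_of_surj W p hp2 hgood hord
      hsurj,
    fun ℓ _ hm ↦ not_dvd_padicValInt_minimalDiscriminantInt_of_natAbs_lt W hΔ ℓ hm,
    not_dvd_ordMinimalDiscriminant_of_natAbs_lt W hΔ, hsplK,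
    Literature.SatisfiesHeegnerHypothesis.not_dvd_discr hK.1 hsplK hpP (dvd_refl p)⟩

end Summit.BirchSwinnertonDyer.BirchSwinnertonDyer.Theorems.KolyvaginDepthDoor

end
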